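import Literature.Computability.ImplicitComplexity.STASubstitution
import Literature.Computability.ImplicitComplexity.SoftTypeAssignmentFreeVars
import Literature.Computability.ImplicitComplexity.SoftTypeAssignmentWeighted
import Mathlib.Tactic.Linarith
import Mathlib.Tactic.Ring
import HarnessLib

/-!
# Measured derivations of `STA` proper (GMR08 Def. A.1): rank, degree, weight

Support file for the `PTIME` soundness half of `STACapturesP` (GMR08 Thm. 3.5). The polynomial
bound on β-reduction sequences of an `STA`-typed term is proved in [GR07]/[GMR08, §3.1 and
App. A] through four measures of a derivation `Π ▹ Γ ⊢ M : σ`: the size `|M|` of the subject,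
the RANK `rk(Π)` (maximal number of premises contracted by a multiplexor `(m)`), the DEGREE
`d(Π)` (maximal nesting of `(sp)`), and the WEIGHT `W(Π, r)`, a polynomial in `r` of degree
`d(Π)`:

* `W((Ax), r) = 1`, `W((⊸I) Σ, r) = W(Σ, r) + 1`, `W((⊸E) Σ Θ, r) = W(Σ, r) + W(Θ, r) + 1`,
  `W((sp) Σ, r) = r · W(Σ, r)`, and `W = W(Σ, r)` for `(w)`, `(m)`, `(∀I)`, `(∀E)`
  (GMR08 Def. A.1).

Since `STA.Typing` of `SoftTypeAssignment.lean` is a `Prop` (derivations are not data), we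
re-present the system with the measures as INDICES: `STA.MTyping r w d Γ M σ` says that
`Γ ⊢ M : σ` has a derivation in `STA` PROPER — the rules of GMR08 Table 2 WITHOUT the `(sum)` rule
of `STA₊` — of degree `d`, all of whose multiplexors have rank `≤ r`, and whose weight at `r` is
`w`, with the same index order as the tree's `STA.WTyping r w d Γ M σ` of
`SoftTypeAssignmentWeighted.lean` (the analogous judgement for the whole of `STA₊`, with the `(sum)`
rule and weight `max W₁ W₂ + 1` there). The two are ONE notion up to the proved equivalence
`mtyping_iff_wtyping_and_sumFree : MTyping r w d Γ M σ ↔ WTyping r w d Γ M σ ∧ M.SumFree`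
(`MTyping.wtyping`, `MTyping.of_wtyping`); `MTyping` is kept as an inductive only for its recursor,
so that the many inductions on `STA` derivations of the soundness proof have no vacuous `(sum)`
case to discharge. This file proves the elementary relations of GMR08 Lemma 3.3 in this form:

* `Term.FreeIn` (free occurrence of a slot, the recursive `Prop` twin of `Term.fv`),
  `Ctx.BoundedBy` (finite support);
* `MTyping.typing` — forgetting the measures gives back `STA.Typing`; `MTyping.wtyping` /
  `MTyping.of_wtyping` / `mtyping_iff_wtyping_and_sumFree` — the equivalence with the tree's `STA₊`
  judgement `WTyping r w d` on sum-free subjects;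
* `Typing.exists_mtyping` — conversely every `STA` derivation of a sum-free term has finite
  rank, hence is a `MTyping r` derivation for all large `r` (with some weight);
* `MTyping.size_le` — `|M| ≤ W(Π, r)` (`r ≥ 1`);
* `MTyping.le_pow_mul_size` — `W(Π, r) ≤ r^{d(Π)} · |M|` (`r ≥ 1`);
* `MTyping.mono_rank` — raising `r` keeps derivability (the weight can only grow);
* bookkeeping used by the substitution lemma: contexts of derivable judgements have bounded
  support (`MTyping.exists_boundedBy`), and free variables of the subject are declared in the
  context (`MTyping.isSome_of_freeIn`).

## References

* [GaboardiMarionRonchidellarocca2008] GMR08, §3.1 (measures, Lemma 3.3), Def. A.1.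
* [GaboardiRonchiDellaRocca2007] M. Gaboardi, S. Ronchi Della Rocca, A soft type assignment
  system for λ-calculus, CSL 2007, LNCS 4646, §4 (the same measures).
-/

namespace Literature.Computability.ImplicitComplexity

namespace STA

/-! ### Free variables of terms (`Term.size`, `size_rename` are in `SoftTypeAssignmentFreeVars`) -/

/-- `M.FreeIn i`: the variable slot `i` occurs free in `M` (de Bruijn: under a `λ` the slot
number goes up by one). [folklore] -/
def Term.FreeIn : ℕ → Term → Prop
  | i, .var j => j = i
  | i, .app M N => Term.FreeIn i M ∨ Term.FreeIn i N
  | i, .lam M => Term.FreeIn (i + 1) M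
  | i, .sum M N => Term.FreeIn i M ∨ Term.FreeIn i N

/-- `FreeIn` is membership in the finite set `Term.fv` of `SoftTypeAssignmentFreeVars` (the
recursive `Prop` form is what structural inductions over derivations consume). [folklore] -/
theorem Term.freeIn_iff_mem_fv (M : Term) (i : ℕ) : M.FreeIn i ↔ i ∈ M.fv := by
  induction M generalizing i with
  | var j => simp [Term.FreeIn, eq_comm]
  | app M N ihM ihN => simp [Term.FreeIn, ihM, ihN]
  | lam M ih => simp [Term.FreeIn, ih]
  | sum M N ihM ihN => simp [Term.FreeIn, ihM, ihN]

/-- Free variables of a renamed term. [folklore] -/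
theorem Term.freeIn_rename_iff (M : Term) (ρ : ℕ → ℕ) (i : ℕ) :
    (M.rename ρ).FreeIn i ↔ ∃ j, M.FreeIn j ∧ ρ j = i := by
  induction M generalizing ρ i with
  | var k =>
    simp only [Term.rename, Term.FreeIn]
    constructor
    · intro h
      exact ⟨k, rfl, h⟩
    · rintro ⟨j, rfl, h⟩
      exact h
  | app M N ihM ihN =>
    simp only [Term.rename, Term.FreeIn, ihM, ihN]
    constructor
    · rintro (⟨j, hj, h⟩ | ⟨j, hj, h⟩)
      · exact ⟨j, Or.inl hj, h⟩
      · exact ⟨j, Or.inr hj, h⟩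
    · rintro ⟨j, hj | hj, h⟩
      · exact Or.inl ⟨j, hj, h⟩
      · exact Or.inr ⟨j, hj, h⟩
  | lam M ih =>
    simp only [Term.rename, Term.FreeIn, ih]
    constructor
    · rintro ⟨j, hj, h⟩
      cases j with
      | zero => simp at h
      | succ j =>
        refine ⟨j, hj, ?_⟩
        simpa using h
    · rintro ⟨j, hj, h⟩
      exact ⟨j + 1, hj, by simp [h]⟩
  | sum M N ihM ihN =>
    simp only [Term.rename, Term.FreeIn, ihM, ihN]
    constructor
    · rintro (⟨j, hj, h⟩ | ⟨j, hj, h⟩)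
      · exact ⟨j, Or.inl hj, h⟩
      · exact ⟨j, Or.inr hj, h⟩
    · rintro ⟨j, hj | hj, h⟩
      · exact Or.inl ⟨j, hj, h⟩
      · exact Or.inr ⟨j, hj, h⟩

/-- Renamings that agree on the free variables of `M` act identically on `M`. [folklore] -/
theorem Term.rename_congr_freeIn {ρ₁ ρ₂ : ℕ → ℕ} (M : Term)
    (h : ∀ i, M.FreeIn i → ρ₁ i = ρ₂ i) : M.rename ρ₁ = M.rename ρ₂ := by
  induction M generalizing ρ₁ ρ₂ with
  | var k => simp [Term.rename, h k rfl]
  | app M N ihM ihN =>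
    simp [Term.rename, ihM (fun i hi => h i (Or.inl hi)), ihN (fun i hi => h i (Or.inr hi))]
  | lam M ih =>
    simp only [Term.rename]
    congr 1
    refine ih (fun i hi => ?_)
    cases i with
    | zero => rfl
    | succ i => simp [h i hi]
  | sum M N ihM ihN =>
    simp [Term.rename, ihM (fun i hi => h i (Or.inl hi)), ihN (fun i hi => h i (Or.inr hi))]

/-- Substitutions that agree on the free variables of `M` act identically on `M`. [folklore] -/
theorem Term.substp_congr_freeIn {τ₁ τ₂ : ℕ → Term} (M : Term)
    (h : ∀ i, M.FreeIn i → τ₁ i = τ₂ i) : M.substp τ₁ = M.substp τ₂ := by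
  induction M generalizing τ₁ τ₂ with
  | var k => simp [Term.substp, h k rfl]
  | app M N ihM ihN =>
    simp [Term.substp, ihM (fun i hi => h i (Or.inl hi)), ihN (fun i hi => h i (Or.inr hi))]
  | lam M ih =>
    simp only [Term.substp]
    congr 1
    refine ih (fun i hi => ?_)
    cases i with
    | zero => rfl
    | succ i => simp [h i hi]
  | sum M N ihM ihN =>
    simp [Term.substp, ihM (fun i hi => h i (Or.inl hi)), ihN (fun i hi => h i (Or.inr hi))]

/-- A renaming that fixes the free variables of `M` fixes `M`. [folklore] -/
theorem Term.rename_eq_self_of_freeIn {ρ : ℕ → ℕ} (M : Term) (h : ∀ i, M.FreeIn i → ρ i = i) :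
    M.rename ρ = M := by
  rw [Term.rename_congr_freeIn M (ρ₂ := fun i => i) h]
  exact Term.rename_id' M

/-- A substitution that is the identity on the free variables of `M` fixes `M`. [folklore] -/
theorem Term.substp_eq_self_of_freeIn {τ : ℕ → Term} (M : Term)
    (h : ∀ i, M.FreeIn i → τ i = .var i) : M.substp τ = M := by
  rw [Term.substp_congr_freeIn M (τ₂ := Term.var) h]
  exact Term.substp_var M

/-- Renaming reflects sum-freeness. [folklore] -/
theorem Term.SumFree.of_rename {M : Term} {ρ : ℕ → ℕ} (h : (M.rename ρ).SumFree) : M.SumFree := by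
  induction M generalizing ρ with
  | var i => trivial
  | app M N ihM ihN => exact ⟨ihM h.1, ihN h.2⟩
  | lam M ih => exact ih h
  | sum M N _ _ => exact h.elim

/-! ### Contexts: bounded support -/

/-- `Γ.BoundedBy n`: every slot `≥ n` of `Γ` is empty (contexts of derivable judgements are
finite; slots `≥ n` are then fresh). [folklore] -/
def Ctx.BoundedBy (Γ : Ctx) (n : ℕ) : Prop := ∀ i, n ≤ i → Γ i = none

/-- Monotonicity of support bounds. [folklore] -/
theorem Ctx.BoundedBy.mono {Γ : Ctx} {n n' : ℕ} (h : Γ.BoundedBy n) (hn : n ≤ n') : Γ.BoundedBy n' :=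
  fun i hi => h i (hn.trans hi)

/-- The empty context has empty support. [folklore] -/
theorem Ctx.boundedBy_empty (n : ℕ) : Ctx.empty.BoundedBy n := fun _ _ => rfl

/-! ### Weighted derivations -/

/-- `MTyping r w d Γ M σ` ("measured typing"): the judgement `Γ ⊢ M : σ` of `STA` proper (GMR08
Table 2; no `(sum)` rule) has
a derivation `Π` with degree `d(Π) = d` (maximal nesting of `(sp)`), every multiplexor `(m)` of
rank `|S| ≤ r`, and weight `W(Π, r) = w`, where (GMR08 Def. A.1) `W` is `1` at `(Ax)`, `+1` at
`(⊸I)`, `W₁ + W₂ + 1` at `(⊸E)`, multiplied by `r` at `(sp)`, and unchanged by `(w)`, `(m)`,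
`(∀I)`, `(∀E)`. The rules are those of `STA.Typing` verbatim, with these indices added.
[cite: GaboardiMarionRonchidellarocca2008, Table 2 and Def. A.1] -/
inductive MTyping (r : ℕ) : ℕ → ℕ → Ctx → Term → SoftTy → Prop
  | ax {Γ : Ctx} {i : ℕ} {A : LinTy} (h : Γ.IsSingleton i ⟨0, A⟩) :
      MTyping r 1 0 Γ (.var i) ⟨0, A⟩
  | weak {d w : ℕ} {Γ Γ' : Ctx} {M : Term} {τ : SoftTy} (j : ℕ) (A : LinTy)
      (h : MTyping r w d Γ M τ) (hj : Γ j = none) (hΓ' : Γ' = Function.update Γ j (some ⟨0, A⟩)) :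
      MTyping r w d Γ' M τ
  | lam {d w : ℕ} {Γ : Ctx} {M : Term} {k : ℕ} {B A : LinTy}
      (h : MTyping r w d (Ctx.cons (some ⟨k, B⟩) Γ) M ⟨0, A⟩) :
      MTyping r (w + 1) d Γ (.lam M) ⟨0, .limp k B A⟩
  | app {d₁ d₂ w₁ w₂ : ℕ} {Γ Γ₁ Γ₂ : Ctx} {M N : Term} {k : ℕ} {B A : LinTy}
      (hs : Γ.Split Γ₁ Γ₂) (h₁ : MTyping r w₁ d₁ Γ₁ M ⟨0, .limp k B A⟩)
      (h₂ : MTyping r w₂ d₂ Γ₂ N ⟨k, B⟩) :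
      MTyping r (w₁ + w₂ + 1) (max d₁ d₂) Γ (.app M N) ⟨0, A⟩
  | mpx {d w : ℕ} {Γ Γ' : Ctx} {M M' : Term} {μ σ : SoftTy} (S : Finset ℕ) (j : ℕ)
      (h : MTyping r w d Γ M μ) (hS : ∀ i ∈ S, Γ i = some σ) (hj : Γ j = none)
      (hr : S.card ≤ r) (hΓ' : Γ' = Γ.mpx S j σ) (hM' : M' = M.rename (mpxRen S j)) :
      MTyping r w d Γ' M' μ
  | sp {d w : ℕ} {Γ Γ' : Ctx} {M : Term} {k : ℕ} {A : LinTy}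
      (h : MTyping r w d Γ M ⟨k, A⟩) (hΓ' : Γ' = Γ.bang) :
      MTyping r (r * w) (d + 1) Γ' M ⟨k + 1, A⟩
  | allI {d w : ℕ} {Γ Δ : Ctx} {M : Term} {A : LinTy}
      (h : MTyping r w d Δ M ⟨0, A⟩) (hΔ : Δ = Γ.shift) :
      MTyping r w d Γ M ⟨0, .all A⟩
  | allE {d w : ℕ} {Γ : Ctx} {M : Term} {B : LinTy} (A : LinTy)
      (h : MTyping r w d Γ M ⟨0, .all B⟩) :
      MTyping r w d Γ M ⟨0, B.inst A⟩

namespace MTyping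

variable {r d w : ℕ} {Γ : Ctx} {M : Term} {σ : SoftTy}

/-- Forgetting rank and weight: a weighted derivation is an `STA` (`⊆ STA₊`) derivation of the
same degree. [cite: GaboardiMarionRonchidellarocca2008, Table 2] -/
theorem typing (h : MTyping r w d Γ M σ) : Typing d Γ M σ := by
  induction h with
  | ax h => exact Typing.ax h
  | weak j A _ hj hΓ' ih => exact Typing.weak j A ih hj hΓ'
  | lam _ ih => exact Typing.lam ih
  | app hs _ _ ih₁ ih₂ => exact Typing.app hs ih₁ ih₂
  | mpx S j _ hS hj _ hΓ' hM' ih => exact Typing.mpx S j ih hS hj hΓ' hM'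
  | sp _ hΓ' ih => exact Typing.sp ih hΓ'
  | allI _ hΔ ih => exact Typing.allI ih hΔ
  | allE A _ ih => exact Typing.allE A ih

/-- Embedding into the tree's weighted judgement for `STA₊` (`SoftTypeAssignmentWeighted.lean`,
index order `w d`): an `STA` derivation is an `STA₊` derivation with the same measures.
[cite: GaboardiMarionRonchidellarocca2008, Table 2, Table 5 and Def. A.1] -/
theorem wtyping (h : MTyping r w d Γ M σ) : WTyping r w d Γ M σ := by
  induction h with
  | ax h => exact WTyping.ax h
  | weak j A _ hj hΓ' ih => exact WTyping.weak j A ih hj hΓ'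
  | lam _ ih => exact WTyping.lam ih
  | app hs _ _ ih₁ ih₂ => exact WTyping.app hs ih₁ ih₂
  | mpx S j _ hS hj hr hΓ' hM' ih => exact WTyping.mpx S j ih hS hj hr hΓ' hM'
  | sp _ hΓ' ih => exact WTyping.sp ih hΓ'
  | allI _ hΔ ih => exact WTyping.allI ih hΔ
  | allE A _ ih => exact WTyping.allE A ih

/-- The subject of a weighted (`(sum)`-free) derivation is sum-free. [cite: GaboardiMarionRonchidellarocca2008, Def. 3.1 (i)] -/
theorem sumFree (h : MTyping r w d Γ M σ) : M.SumFree := by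
  induction h with
  | ax h => trivial
  | weak j A _ _ _ ih => exact ih
  | lam _ ih => exact ih
  | app _ _ _ ih₁ ih₂ => exact ⟨ih₁, ih₂⟩
  | mpx S j _ _ _ _ _ hM' ih => exact hM' ▸ ih.rename _
  | sp _ _ ih => exact ih
  | allI _ _ ih => exact ih
  | allE A _ ih => exact ih


/-- Conversely, an `STA₊` weighted derivation with a sum-free subject is an `STA` derivation with
the same measures: no rule but `(sum)` has a sum in its subject, and `(sum)` cannot occur.
[cite: GaboardiMarionRonchidellarocca2008, Table 2, Table 5] -/
theorem of_wtyping {w d : ℕ} {Γ : Ctx} {M : Term} {σ : SoftTy} (h : WTyping r w d Γ M σ) (hM : M.SumFree) :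
    MTyping r w d Γ M σ := by
  induction h with
  | ax h => exact MTyping.ax h
  | weak j A _ hj hΓ' ih => exact MTyping.weak j A (ih hM) hj hΓ'
  | lam _ ih => exact MTyping.lam (ih hM)
  | app hs _ _ ih₁ ih₂ => exact MTyping.app hs (ih₁ hM.1) (ih₂ hM.2)
  | mpx S j _ hS hj hr hΓ' hM' ih =>
    subst hM'
    exact MTyping.mpx S j (ih (Term.SumFree.of_rename hM)) hS hj hr hΓ' rfl
  | sp _ hΓ' ih => exact MTyping.sp (ih hM) hΓ'
  | allI _ hΔ ih => exact MTyping.allI (ih hM) hΔ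
  | allE A _ ih => exact MTyping.allE A (ih hM)
  | sum _ _ _ _ => exact absurd hM (by simp [Term.SumFree])

/-- **`MTyping` is `WTyping` on sum-free subjects** (same rank bound, weight and degree): the
tree carries one notion of weighted derivation up to this proved equivalence; `MTyping` is kept
as an inductive only for its recursor (inductions on `STA` derivations without a vacuous `(sum)`
case). [cite: GaboardiMarionRonchidellarocca2008, Table 2, Table 5, Def. A.1] -/
theorem _root_.Literature.Computability.ImplicitComplexity.STA.mtyping_iff_wtyping_and_sumFree
    {w d : ℕ} {Γ : Ctx} {M : Term} {σ : SoftTy} : MTyping r w d Γ M σ ↔ WTyping r w d Γ M σ ∧ M.SumFree :=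
  ⟨fun h => ⟨h.wtyping, h.sumFree⟩, fun h => of_wtyping h.1 h.2⟩
/-- **`|M| ≤ W(Π, r)`** for `r ≥ 1` (GMR08 Lemma 3.3): the weight bounds the size of the subject,
hence — along a reduction, by the weight decrease — the size of every reduct.
[cite: GaboardiMarionRonchidellarocca2008, Lemma 3.3] -/
theorem size_le (h : MTyping r w d Γ M σ) (hr : 1 ≤ r) : M.size ≤ w := by
  induction h with
  | ax h => simp [Term.size]
  | weak j A _ _ _ ih => exact ih
  | lam _ ih => simpa [Term.size] using ih
  | app _ _ _ ih₁ ih₂ => simp [Term.size]; omega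
  | mpx S j _ _ _ _ _ hM' ih => rw [hM', Term.size_rename]; exact ih
  | sp _ _ ih => exact ih.trans (Nat.le_mul_of_pos_left _ hr)
  | allI _ _ ih => exact ih
  | allE A _ ih => exact ih

/-- **`W(Π, r) ≤ r^{d(Π)} · |M|`** for `r ≥ 1` (GMR08 Lemma 3.3): the weight is a polynomial in the
rank of degree the degree of the derivation. [cite: GaboardiMarionRonchidellarocca2008, Lemma 3.3] -/
theorem le_pow_mul_size (h : MTyping r w d Γ M σ) (hr : 1 ≤ r) : w ≤ r ^ d * M.size := by
  induction h with
  | ax h => simp [Term.size]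
  | weak j A _ _ _ ih => exact ih
  | @lam d w Γ M k B A _ ih =>
    have h1 : 1 ≤ r ^ d := Nat.one_le_pow _ _ hr
    simp only [Term.size]
    nlinarith
  | @app d₁ d₂ w₁ w₂ Γ Γ₁ Γ₂ M N k B A _ _ _ ih₁ ih₂ =>
    have hp₁ : r ^ d₁ ≤ r ^ max d₁ d₂ := Nat.pow_le_pow_right hr (le_max_left _ _)
    have hp₂ : r ^ d₂ ≤ r ^ max d₁ d₂ := Nat.pow_le_pow_right hr (le_max_right _ _)
    have h1 : 1 ≤ r ^ max d₁ d₂ := Nat.one_le_pow _ _ hr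
    have e₁ : w₁ ≤ r ^ max d₁ d₂ * M.size := ih₁.trans (Nat.mul_le_mul_right _ hp₁)
    have e₂ : w₂ ≤ r ^ max d₁ d₂ * N.size := ih₂.trans (Nat.mul_le_mul_right _ hp₂)
    simp only [Term.size]
    nlinarith
  | mpx S j _ _ _ _ _ hM' ih => rw [hM', Term.size_rename]; exact ih
  | @sp d w Γ Γ' M k A _ _ ih =>
    calc r * w ≤ r * (r ^ d * M.size) := Nat.mul_le_mul_left _ ih
      _ = r ^ (d + 1) * M.size := by ring
  | allI _ _ ih => exact ih
  | allE A _ ih => exact ih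

/-- **Raising the rank parameter.** A derivation with multiplexor ranks `≤ r` also has ranks
`≤ r'` for `r ≤ r'`; its weight at `r'` is at least its weight at `r` (`W` is monotone in `r`).
[cite: GaboardiMarionRonchidellarocca2008, Def. A.1] -/
theorem mono_rank (h : MTyping r w d Γ M σ) {r' : ℕ} (hr : r ≤ r') :
    ∃ w', w ≤ w' ∧ MTyping r' w' d Γ M σ := by
  induction h with
  | ax h => exact ⟨1, le_rfl, MTyping.ax h⟩
  | weak j A _ hj hΓ' ih =>
    obtain ⟨w', hw, h'⟩ := ih
    exact ⟨w', hw, MTyping.weak j A h' hj hΓ'⟩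
  | lam _ ih =>
    obtain ⟨w', hw, h'⟩ := ih
    exact ⟨w' + 1, by omega, MTyping.lam h'⟩
  | app hs _ _ ih₁ ih₂ =>
    obtain ⟨w₁', hw₁, h₁'⟩ := ih₁
    obtain ⟨w₂', hw₂, h₂'⟩ := ih₂
    exact ⟨w₁' + w₂' + 1, by omega, MTyping.app hs h₁' h₂'⟩
  | mpx S j _ hS hj hrk hΓ' hM' ih =>
    obtain ⟨w', hw, h'⟩ := ih
    exact ⟨w', hw, MTyping.mpx S j h' hS hj (hrk.trans hr) hΓ' hM'⟩
  | sp _ hΓ' ih =>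
    obtain ⟨w', hw, h'⟩ := ih
    exact ⟨r' * w', Nat.mul_le_mul hr hw, MTyping.sp h' hΓ'⟩
  | allI _ hΔ ih =>
    obtain ⟨w', hw, h'⟩ := ih
    exact ⟨w', hw, MTyping.allI h' hΔ⟩
  | allE A _ ih =>
    obtain ⟨w', hw, h'⟩ := ih
    exact ⟨w', hw, MTyping.allE A h'⟩

/-- Contexts of derivable judgements have bounded (finite) support. [folklore] -/
theorem exists_boundedBy (h : MTyping r w d Γ M σ) : ∃ n, Γ.BoundedBy n := by
  induction h with
  | @ax Γ i A h => exact ⟨i + 1, fun j hj => h.2 j (by omega)⟩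
  | @weak d w Γ Γ' M τ j A _ hj hΓ' ih =>
    obtain ⟨n, hn⟩ := ih
    refine ⟨max n (j + 1), fun i hi => ?_⟩
    rw [hΓ', Function.update_of_ne (by omega)]
    exact hn i (by omega)
  | @lam d w Γ M k B A _ ih =>
    obtain ⟨n, hn⟩ := ih
    exact ⟨n, fun i hi => hn (i + 1) (by omega)⟩
  | @app d₁ d₂ w₁ w₂ Γ Γ₁ Γ₂ M N k B A hs _ _ ih₁ ih₂ =>
    obtain ⟨n₁, hn₁⟩ := ih₁
    obtain ⟨n₂, hn₂⟩ := ih₂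
    refine ⟨max n₁ n₂, fun i hi => ?_⟩
    rcases hs i with ⟨h₁, -⟩ | ⟨-, h₂⟩
    · rw [← h₁]; exact hn₁ i (by omega)
    · rw [← h₂]; exact hn₂ i (by omega)
  | @mpx d w Γ Γ' M M' μ σ S j _ hS hj _ hΓ' hM' ih =>
    obtain ⟨n, hn⟩ := ih
    refine ⟨max n (j + 1), fun i hi => ?_⟩
    rw [hΓ']
    simp only [Ctx.mpx]
    split_ifs with h1 h2
    · rfl
    · omega
    · exact hn i (by omega)
  | @sp d w Γ Γ' M k A _ hΓ' ih =>
    obtain ⟨n, hn⟩ := ih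
    exact ⟨n, fun i hi => by rw [hΓ']; simp [Ctx.bang, hn i hi]⟩
  | @allI d w Γ Δ M A _ hΔ ih =>
    obtain ⟨n, hn⟩ := ih
    refine ⟨n, fun i hi => ?_⟩
    have := hn i hi
    rw [hΔ] at this
    simpa [Ctx.shift] using this
  | allE A _ ih => exact ih

/-- **Free variables are declared**: if slot `i` occurs free in the subject then the context
assigns it a type. [folklore] -/
theorem isSome_of_freeIn (h : MTyping r w d Γ M σ) {i : ℕ} (hi : M.FreeIn i) : Γ i ≠ none := by
  induction h generalizing i with
  | @ax Γ i₀ A h =>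
    simp only [Term.FreeIn] at hi
    subst hi
    rw [h.1]
    simp
  | @weak d w Γ Γ' M τ j A _ hj hΓ' ih =>
    rw [hΓ']
    by_cases hij : i = j
    · subst hij; simp
    · rw [Function.update_of_ne hij]; exact ih hi
  | @lam d w Γ M k B A _ ih => exact ih hi
  | @app d₁ d₂ w₁ w₂ Γ Γ₁ Γ₂ M N k B A hs _ _ ih₁ ih₂ =>
    rcases hi with hi | hi
    · have := ih₁ hi
      rcases hs i with ⟨h₁, -⟩ | ⟨h₁, -⟩
      · rwa [← h₁]
      · exact (this h₁).elim
    · have := ih₂ hi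
      rcases hs i with ⟨-, h₂⟩ | ⟨-, h₂⟩
      · exact (this h₂).elim
      · rwa [← h₂]
  | @mpx d w Γ Γ' M M' μ σ S j _ hS hj _ hΓ' hM' ih =>
    rw [hM'] at hi
    obtain ⟨i₀, hi₀, hρ⟩ := (Term.freeIn_rename_iff M _ i).1 hi
    have hΓi₀ := ih hi₀
    have hjS : j ∉ S := fun hjS => by rw [hS j hjS] at hj; exact Option.some_ne_none _ hj
    rw [hΓ']
    simp only [Ctx.mpx]
    simp only [mpxRen] at hρ
    split_ifs at hρ with h0
    · subst hρ
      simp [hjS]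
    · subst hρ
      simp only [h0, if_false]
      split_ifs with h1
      · simp
      · exact hΓi₀
  | @sp d w Γ Γ' M k A _ hΓ' ih =>
    rw [hΓ']
    simpa [Ctx.bang] using ih hi
  | @allI d w Γ Δ M A _ hΔ ih =>
    have := ih hi
    rw [hΔ] at this
    simpa [Ctx.shift] using this
  | allE A _ ih => exact ih hi

/-- Slots outside the support are not free in the subject. [folklore] -/
theorem not_freeIn_of_none (h : MTyping r w d Γ M σ) {i : ℕ} (hi : Γ i = none) : ¬M.FreeIn i :=
  fun hf => h.isSome_of_freeIn hf hi

end MTyping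

/-! ### From `STA.Typing` to weighted derivations -/

/-- **Every `STA` derivation of a sum-free term is a weighted derivation for all large rank
parameters**: if `Π ▹ Γ ⊢ M : σ` with degree `d` and `M ∈ Λ`, then for some `r₀` (the rank
`rk(Π)`) and every `r ≥ r₀` there is `w = W(Π, r)` with `MTyping r w d Γ M σ`. (A derivation of a
sum-free subject never uses `(sum)`.) [cite: GaboardiMarionRonchidellarocca2008, §3.1 and Def. A.1] -/
theorem Typing.exists_mtyping {d : ℕ} {Γ : Ctx} {M : Term} {σ : SoftTy} (h : Typing d Γ M σ)
    (hM : M.SumFree) : ∃ r₀, ∀ r, r₀ ≤ r → ∃ w, MTyping r w d Γ M σ := by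
  induction h with
  | ax h => exact ⟨0, fun r _ => ⟨1, MTyping.ax h⟩⟩
  | weak j A _ hj hΓ' ih =>
    obtain ⟨r₀, hr₀⟩ := ih hM
    refine ⟨r₀, fun r hr => ?_⟩
    obtain ⟨w, hw⟩ := hr₀ r hr
    exact ⟨w, MTyping.weak j A hw hj hΓ'⟩
  | lam _ ih =>
    obtain ⟨r₀, hr₀⟩ := ih hM
    refine ⟨r₀, fun r hr => ?_⟩
    obtain ⟨w, hw⟩ := hr₀ r hr
    exact ⟨w + 1, MTyping.lam hw⟩
  | app hs _ _ ih₁ ih₂ =>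
    obtain ⟨r₁, hr₁⟩ := ih₁ hM.1
    obtain ⟨r₂, hr₂⟩ := ih₂ hM.2
    refine ⟨max r₁ r₂, fun r hr => ?_⟩
    obtain ⟨w₁, hw₁⟩ := hr₁ r (le_of_max_le_left hr)
    obtain ⟨w₂, hw₂⟩ := hr₂ r (le_of_max_le_right hr)
    exact ⟨w₁ + w₂ + 1, MTyping.app hs hw₁ hw₂⟩
  | mpx S j _ hS hj hΓ' hM' ih =>
    subst hM'
    obtain ⟨r₀, hr₀⟩ := ih (Term.SumFree.of_rename hM)
    refine ⟨max r₀ S.card, fun r hr => ?_⟩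
    obtain ⟨w, hw⟩ := hr₀ r (le_of_max_le_left hr)
    exact ⟨w, MTyping.mpx S j hw hS hj (le_of_max_le_right hr) hΓ' rfl⟩
  | sp _ hΓ' ih =>
    obtain ⟨r₀, hr₀⟩ := ih hM
    refine ⟨r₀, fun r hr => ?_⟩
    obtain ⟨w, hw⟩ := hr₀ r hr
    exact ⟨r * w, MTyping.sp hw hΓ'⟩
  | allI _ hΔ ih =>
    obtain ⟨r₀, hr₀⟩ := ih hM
    refine ⟨r₀, fun r hr => ?_⟩
    obtain ⟨w, hw⟩ := hr₀ r hr
    exact ⟨w, MTyping.allI hw hΔ⟩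
  | allE A _ ih =>
    obtain ⟨r₀, hr₀⟩ := ih hM
    refine ⟨r₀, fun r hr => ?_⟩
    obtain ⟨w, hw⟩ := hr₀ r hr
    exact ⟨w, MTyping.allE A hw⟩
  | sum _ _ _ _ => exact hM.elim

end STA

end Literature.Computability.ImplicitComplexity
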